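import Literature.AlgebraicGeometry.Frobenioids.ArchimedeanBasicProperties
import Literature.AlgebraicGeometry.Frobenioids.AngularFrobenioidsRelative
import Literature.AlgebraicGeometry.Frobenioids.ArchimedeanHullArrow
import HarnessLib

/-!
# Frobenioids II, Theorem 3.6 (i), first clauses — PROVED for `C = C^ℤ` over any base:
# "`(C^Λ)^istr` is of isotropic, base-trivial type"

Mochizuki, *The geometry of Frobenioids II*, Kyushu J. Math. **62** (2008) 401–460, §3, Theorem 3.6
(i), author's kurims text p. 36 [cite: MochizukiFrdII2008, Thm 3.6 (i) p.36]: "The Frobenioid `(C^Λ)^istr`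
is of isotropic, base-trivial, and model type …". This file discharges, for the archimedean Frobenioid
`C = C₀ ×_{D₀} D` of Example 3.3 over any base `π : D → D₀` (`AngularFrobenioidsRelative.lean`, seat
abc-iut-L1-t6; the case `Λ = ℤ`), the predicate `ArchFrd.Thm36i_istrTypes` of
`ArchimedeanBasicProperties.lean`:

* generically, for ANY pre-Frobenioid structure `F`, the restriction `istr F` of `F` to the full
  subcategory of isotropic objects is of isotropic type (the inclusion is fully faithful, so it reflects
  isomorphisms; [FrdI] Prop. 1.9 (v) "`C^istr` … of isotropic type" — a one-line piece of that
  Proposition, seat abc-iut-L1-t1, recorded here under `ArchFrd.` only to discharge Thm. 3.6 (i));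
* for `C`, base-trivial type of `C^istr`: two isotropic objects over isomorphic base objects are
  isomorphic, by the rescaling arrow `(β, deg_Fr = 1, scalar = tip_Y/tip_X)` between naively isotropic
  objects of `C₀` lying over an isomorphism `β` of `D₀` (`C0.isoOfIsotropic`) — granted Example 3.3 (ii)'s
  "isotropic ⟺ naively isotropic" (seat abc-iut-L1-t6, named statement; here the hypothesis `hiso`).

No statement of the paper is strengthened.
-/

namespace Literature.AlgebraicGeometry.Frobenioids

open CategoryTheory
open scoped Pointwise

universe w v v' u u'

namespace ArchFrd

section Generic

variable {D : Type u} [Category.{v} D] {Φ : Dᵒᵖ ⥤ CommMonCat.{w}} {X : Type u'} [Category.{v'} X]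
  (F : X ⥤ ElemFrobenioid Φ)

/-- `F^istr` is of isotropic type, for any pre-Frobenioid structure `F` ([FrdI] Prop. 1.9 (v); the
inclusion of the full subcategory of isotropic objects reflects isomorphisms).
[cite: MochizukiFrdI2008, Prop. 1.9 (v) p.31] -/
theorem isOfIsotropicType_istr : PreFrobenioid.IsOfIsotropicType (istr F) := by
  intro A B ψ hψ₁ hψ₂
  have h : IsIso ((PreFrobenioid.isotropicObjects F).ι.map ψ) := A.property ψ.hom hψ₁ hψ₂
  exact isIso_of_fully_faithful (PreFrobenioid.isotropicObjects F).ι ψ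

end Generic

section Model

variable {D : Type u} [Category.{v} D] (π : D ⥤ D0)

/-- `(tip_Y/tip_X) · (tip_X/tip_Y) = 1` for the rescaling scalars. [cite: MochizukiFrdII2008, Ex 3.3 (iv) p.29] -/
theorem rescale_mul_rescale (X Y : C0) : N0.rescale X Y * N0.rescale Y X = 1 := by
  rw [N0.rescale, N0.rescale, ← map_mul]
  convert map_one (ofPosReal ℂ)
  apply Subtype.ext
  rw [Positive.val_mul, Positive.val_one]
  change Y.tip / X.tip * (X.tip / Y.tip) = 1
  rw [div_mul_div_comm, mul_comm, div_self (mul_ne_zero X.tip_pos.ne' Y.tip_pos.ne')]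

/-- The rescaling isomorphism of `C₀` between naively isotropic objects over an isomorphism of `D₀`:
`(β, deg_Fr = 1, scalar = tip_Y / tip_X)` with inverse `(β⁻¹, 1, tip_X / tip_Y)`.
[cite: MochizukiFrdII2008, Thm 3.6 (i) p.36] -/
noncomputable def C0.isoOfIsotropic {X Y : C0} (β : X.base ≅ Y.base) (hX : X.IsNaivelyIsotropic)
    (hY : Y.IsNaivelyIsotropic) : X ≅ Y where
  hom :=
    { base := β.hom, degFr := 1, scalar := N0.rescale X Y,
      scalar_mem := N0.rescale_mem_scalars _ _ _,
      mapsTo := (N0.rescale_smul_subset hX hY).trans (by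
        change Y.region.carrier ⊆ D0.galAct (D0.Hom.twists β.hom) '' Y.region.carrier
        rw [C0.image_galAct_of_isIsotropic hY]) }
  inv :=
    { base := β.inv, degFr := 1, scalar := N0.rescale Y X,
      scalar_mem := N0.rescale_mem_scalars _ _ _,
      mapsTo := (N0.rescale_smul_subset hY hX).trans (by
        change X.region.carrier ⊆ D0.galAct (D0.Hom.twists β.inv) '' X.region.carrier
        rw [C0.image_galAct_of_isIsotropic hX]) }
  hom_inv_id := by
    refine C0.hom_ext β.hom_inv_id rfl ?_
    rw [C0.scalar_comp', C0.scalar_id']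
    change D0.galAct (D0.Hom.twists β.hom) (N0.rescale Y X) * N0.rescale X Y ^ ((1 : ℕ+) : ℕ) = 1
    rw [D0.galAct_eq_self_of_mem_scalars_real _ (N0.rescale_mem_scalars Y X .real), PNat.one_coe,
      pow_one, mul_comm, rescale_mul_rescale]
  inv_hom_id := by
    refine C0.hom_ext β.inv_hom_id rfl ?_
    rw [C0.scalar_comp', C0.scalar_id']
    change D0.galAct (D0.Hom.twists β.inv) (N0.rescale X Y) * N0.rescale Y X ^ ((1 : ℕ+) : ℕ) = 1
    rw [D0.galAct_eq_self_of_mem_scalars_real _ (N0.rescale_mem_scalars X Y .real), PNat.one_coe,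
      pow_one, mul_comm, rescale_mul_rescale]

/-- An isomorphism of `C = C₀ ×_{D₀} D` between objects with naively isotropic `C₀`-components, lying
over a given isomorphism of their base objects in `D`. [cite: MochizukiFrdII2008, Thm 3.6 (i) p.36] -/
noncomputable def isoOverOfIsotropic (A B : C π) (e : A.snd ≅ B.snd)
    (hA : A.fst.IsNaivelyIsotropic) (hB : B.fst.IsNaivelyIsotropic) : A ≅ B :=
  CFP.isoMk (C0.isoOfIsotropic (A.iso ≪≫ π.mapIso e ≪≫ B.iso.symm) hA hB) e (by
    change (A.iso ≪≫ π.mapIso e ≪≫ B.iso.symm).hom ≫ B.iso.hom = A.iso.hom ≫ π.map e.hom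
    simp)

/-- **Theorem 3.6 (i), first clauses, for `C = C^ℤ`** (PROVED, granted Ex. 3.3 (ii)'s "isotropic ⟹
naively isotropic", hypothesis `hiso`): `C^istr` is of isotropic and base-trivial type.
[cite: MochizukiFrdII2008, Thm 3.6 (i) p.36] -/
theorem thm36i_istrTypes_C
    (hiso : ∀ X : C π, PreFrobenioid.IsIsotropic (C.toElem π) X → X.fst.IsNaivelyIsotropic) :
    Thm36i_istrTypes (C.toElem π) := by
  refine ⟨isOfIsotropicType_istr (C.toElem π), fun A B ⟨e⟩ => ?_⟩
  -- `e : baseObj B ≅ baseObj A` in `D`, i.e. `B.obj.snd ≅ A.obj.snd`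
  exact ⟨(PreFrobenioid.isotropicObjects (C.toElem π)).ι.preimageIso
    (isoOverOfIsotropic π B.obj A.obj e.symm (hiso _ B.property) (hiso _ A.property))⟩

/-- The arrow of `C` over the identity of `D` from `X` to the object with the same base data and the
isotropic angular region of the same tip (first component `C0.hullArrow`).
[cite: MochizukiFrdII2008, Ex 3.3 (ii) p.28] -/
noncomputable def hullArrowOver (X : C π) :
    X ⟶ (⟨⟨X.fst.base, AngularRegion.isotropicOfTip X.fst.region.tip,
      fun _ => AngularRegion.isIsotropic_isotropicOfTip _⟩, X.snd, X.iso⟩ : C π) where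
  fst := C0.hullArrow X.fst
  snd := 𝟙 X.snd
  w := by
    change 𝟙 _ ≫ X.iso.hom = X.iso.hom ≫ π.map (𝟙 X.snd)
    rw [CategoryTheory.Functor.map_id, Category.id_comp, Category.comp_id]

/-- In `C`, an object isotropic in the sense of [FrdI] Def. 1.2 (iv) has naively isotropic
`C₀`-component (Ex. 3.3 (ii), direction `⇒`, relative version; abc-iut-L1-t6's `Ex33ii_isotropic_iff`
is the full statement): `hullArrowOver X` is an isometric pre-step, hence an isomorphism, hence so is
its `C₀`-component. [cite: MochizukiFrdII2008, Ex 3.3 (ii) p.28] -/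
theorem isNaivelyIsotropic_fst_of_isIsotropic (X : C π)
    (h : PreFrobenioid.IsIsotropic (C.toElem π) X) : X.fst.IsNaivelyIsotropic := by
  obtain ⟨hi, hl, -⟩ := C0.isIsometry_isPreStep_hullArrow X.fst
  have hiso : PreFrobenioid.IsIsometry (C.toElem π) (hullArrowOver π X) := by
    change pull Φ₀ X.iso.inv (PreFrobenioid.Div C0.toElem (C0.hullArrow X.fst)) = 1
    rw [hi]; exact map_one _
  have hpre : PreFrobenioid.IsPreStep (C.toElem π) (hullArrowOver π X) := by
    refine ⟨hl, ?_⟩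
    change IsIso (𝟙 X.snd)
    infer_instance
  haveI : IsIso (hullArrowOver π X) := h _ hiso hpre
  haveI : IsIso (C0.hullArrow X.fst) := CFP.isIso_fst (hullArrowOver π X)
  exact C0.isNaivelyIsotropic_of_isIso_hullArrow X.fst

/-- **Theorem 3.6 (i), first clauses, for `C = C^ℤ`, UNCONDITIONALLY** (PROVED): `C^istr` is of isotropic
and base-trivial type. [cite: MochizukiFrdII2008, Thm 3.6 (i) p.36] -/
theorem thm36i_istrTypes_C' : Thm36i_istrTypes (C.toElem π) :=
  thm36i_istrTypes_C π (isNaivelyIsotropic_fst_of_isIsotropic π)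

end Model

end ArchFrd

end Literature.AlgebraicGeometry.Frobenioids
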